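import Mathlib
import Literature.AlgebraicGeometry.Resolution.NormalizationLocalModel
import Literature.AlgebraicGeometry.Resolution.GiraudNormalFormTransport
import Literature.AlgebraicGeometry.Resolution.KummerChartFromSections
import Summits.ResolutionOfSingularities.ResolutionOfSingularities.Theorems.PAlterationPicoverLocalModelLocalChartsKummer
import Summits.ResolutionOfSingularities.ResolutionOfSingularities.Theorems.PAlterationPicoverLocalModelLocalChartsPointwise
import Summits.ResolutionOfSingularities.ResolutionOfSingularities.Theorems.PAlterationPicoverLocalModelBoundaryTypes

/-!
# Crux `PicoverLocalModel` (stmt-ResolutionOfSingularities-0557), line `SketchIdeator3`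
# (giraud-cossart-normal-form) — endgame, local charts: the global charts are log regular at
# every prime of the chart ring (dispatch to the local models)

Helper of the stub `stub_localCharts`. Let `A = Γ(W, U) → B = Γ(Y^ν, V)` be the sections of
the normalised `p`-cyclic cover over an affine open `U` of the base carrying boundary equations
`x_1, …, x_r ∈ A` ((x_j) prime) and the radicand of the centre `w ∈ U` spread to `U`: twisted
Kummer form `a - g^p = u₁^p x^A` (Kummer centre, chart `Φ : kummerCone → B`, `Φ(v)^p = x^{e(v)}`)
or wound/transversal form (orthant chart `v ↦ x^v`). For a prime `𝔓 ⊂ B` over `𝔮 ⊂ A` with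
local rings `O = A_𝔮` (regular, carrying the Giraud normal form and the snc independence of the
point) and `N = B_𝔓`, and the centre's local ring `O₀ = A_{𝔮₀}`, this file proves Kato's
condition (2.1) for `Φ` at `N` and the divisorial description of the stalk monoid
(`localChart_pointwise_kummer`, `localChart_pointwise_orthant`): the local model
`M = B ⊗_A O` is fed to `isLogRegularLocal_of_kummerForm` (some exponent at the point prime
to `p`), resp. to `isLogRegularLocal_kummerChart_of_dvd` / `isLogRegularLocal_orthantChart`
(all exponents divisible: the boundary components through the point are of wound type, read at
the centre and transported along `(O₀)_{(x_j)} = A_{(x_j)} = O_{(x_j)}`, so the Giraud form at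
the point is the wound/transversal one, `woundForm_of_forall_isWoundTypeAt`); `M` turns out
local, hence `M = B_𝔓 = N` (`IsLocalization.atPrime_of_isLocalRing`).
-/

noncomputable section

-- single-problem summit: the doubled namespace component `ResolutionOfSingularities` is the tree layout
set_option linter.dupNamespace false

open IsLocalRing Polynomial Literature.AlgebraicGeometry.Resolution

namespace Summit.ResolutionOfSingularities.ResolutionOfSingularities.Theorems.PicoverLocalModel.LocalCharts

universe u

/-! ## Transfer from the local model `M = B ⊗_A O` to `N = B_𝔓` -/

/-- If the local model `M` of `B` over the point `𝔮` is local, Kato's condition and the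
divisorial identity pass from `M` to any localization `N` of `B` at `𝔓`. [folklore] -/
theorem transfer_of_isLocalRing_localModel {A B O M N : Type u} [CommRing A] [CommRing B]
    [CommRing O] [CommRing M] [CommRing N] [Algebra A B] [Algebra.IsIntegral A B] [Algebra A O]
    [Algebra B M] [Algebra O M] [Algebra A M] [IsScalarTower A B M] [IsScalarTower A O M]
    [Algebra B N] (𝔓 : Ideal B) [𝔓.IsPrime]
    [IsLocalization.AtPrime O (𝔓.comap (algebraMap A B))]
    [IsLocalization (Algebra.algebraMapSubmonoid B (𝔓.comap (algebraMap A B)).primeCompl) M]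
    [IsLocalization.AtPrime N 𝔓] (hloc : IsLocalRing M) {n : ℕ} (P : AddSubmonoid (Fin n → ℤ))
    (Φ : Multiplicative P →* B) (y : O)
    (hlog : LogChart.IsLogRegularLocal P ((algebraMap B M).toMonoidHom.comp Φ))
    (hdiv : divisorialMonoid (Ideal.span {algebraMap O M y}) =
      IsUnit.submonoid M ⊔ MonoidHom.mrange ((algebraMap B M).toMonoidHom.comp Φ)) :
    LogChart.IsLogRegularLocal P ((algebraMap B N).toMonoidHom.comp Φ) ∧
    ∀ σN : O →+* N, σN.comp (algebraMap A O) = (algebraMap B N).comp (algebraMap A B) →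
      divisorialMonoid (Ideal.span {σN y}) =
        IsUnit.submonoid N ⊔ MonoidHom.mrange ((algebraMap B N).toMonoidHom.comp Φ) := by
  haveI := hloc
  haveI : IsLocalization.AtPrime M 𝔓 := IsLocalization.atPrime_of_isLocalRing (A := A) 𝔓 M
  let e : M ≃ₐ[B] N := IsLocalization.algEquiv 𝔓.primeCompl M N
  have hchart : e.toRingEquiv.toMonoidHom.comp ((algebraMap B M).toMonoidHom.comp Φ) =
      (algebraMap B N).toMonoidHom.comp Φ := by
    ext v
    exact e.commutes _
  refine ⟨?_, fun σN hσN => ?_⟩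
  · rw [← hchart]
    exact (LogChart.isLogRegularLocal_comp_equiv P _ e.toRingEquiv).mpr hlog
  · have hcomp := ringEquiv_comp_algebraMap_localModel (𝔓.comap (algebraMap A B)) e σN hσN
    have hy : σN y = e (algebraMap O M y) := by rw [← hcomp]; rfl
    rw [hy, show Ideal.span {e (algebraMap O M y)} =
        (Ideal.span {algebraMap O M y}).map (e.toRingEquiv : M →+* N) by
      rw [Ideal.map_span, Set.image_singleton]; rfl,
      ← divisorialMonoid_map_ringEquiv, hdiv, map_sup_mrange_ringEquiv, hchart]

/-! ## Enumerating the boundary coordinates through a point -/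

/-- An injective enumeration of a finite set of indices. [folklore] -/
theorem exists_enum (r : ℕ) (J : Finset (Fin r)) :
    ∃ (s : ℕ) (σ : Fin s → Fin r), Function.Injective σ ∧ ∀ j, j ∈ J ↔ ∃ i, σ i = j := by
  refine ⟨J.card, fun i => (J.equivFin.symm i : Fin r), fun i i' h =>
    J.equivFin.symm.injective (Subtype.ext h), fun j => ⟨fun hj => ⟨J.equivFin ⟨j, hj⟩, by simp⟩, ?_⟩⟩
  rintro ⟨i, rfl⟩
  exact (J.equivFin.symm i).2

/-! ## The Kummer chart at every prime -/

/-- **The Kummer chart is log regular at every prime, with divisorial stalk monoids.** See the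
module docstring. [cite: Kato1994, Def. (2.1) and Thm. 11.6] -/
theorem localChart_pointwise_kummer : ∀ {A B O₀ O N : Type u} [CommRing A] [IsDomain A] [CommRing B] [IsDomain B] [IsIntegrallyClosed B] [CommRing O₀] [IsRegularLocalRing O₀] [CommRing O] [IsRegularLocalRing O] [CommRing N] [Algebra A B] [Algebra.IsIntegral A B] [Algebra A O₀] [Algebra A O] [Algebra B N] (p : ℕ) [Fact p.Prime] [CharP A p] {r : ℕ} (x : Fin r → A) (Aexp : Fin r → ℕ) (j₀ : Fin r) (c₀ : ℕ), c₀ * Aexp j₀ % p = 1 → ∀ (a g u₁ : A), IsUnit u₁ → a - g ^ p = u₁ ^ p * ∏ j, x j ^ Aexp j → (∀ j, (Ideal.span {x j}).IsPrime) → Function.Injective (algebraMap A B) → ∀ (t : B), t ^ p = algebraMap A B a → (∀ z : B, ∃ d : A, d ≠ 0 ∧ ∃ q : Polynomial A, algebraMap A B d * z = Polynomial.aeval t q) → ∀ (Φ : Multiplicative (kummerCone p j₀ (fun j => c₀ * Aexp j % p)) →* B), (∀ v : kummerCone p j₀ (fun j => c₀ * Aexp j % p), Φ (Multiplicative.ofAdd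 v) ^ p = algebraMap A B (∏ j, x j ^ (kummerExp p j₀ (fun j => c₀ * Aexp j % p) v j).toNat)) → ∀ (𝔮₀ : Ideal A) [𝔮₀.IsPrime] [IsLocalization.AtPrime O₀ 𝔮₀], (∀ j, x j ∈ 𝔮₀) → (∀ α : Fin r → O₀, ∑ i, α i * algebraMap A O₀ (x i) ∈ IsLocalRing.maximalIdeal O₀ ^ 2 → ∀ i, α i ∈ IsLocalRing.maximalIdeal O₀) → ∀ (𝔓 : Ideal B) [𝔓.IsPrime] [IsLocalization.AtPrime O (𝔓.comap (algebraMap A B))] [IsLocalization.AtPrime N 𝔓], (∀ (s : ℕ) (σ : Fin s → Fin r), Function.Injective σ → (∀ i, x (σ i) ∈ 𝔓.comap (algebraMap A B)) → ∀ α : Fin s → O, ∑ i, α i * algebraMap A O (x (σ i)) ∈ IsLocalRing.maximalIdeal O ^ 2 → ∀ i, α i ∈ IsLocalRing.maximalIdeal O) → (∀ (s : ℕ) (σ : Fin s → Fin r), Function.Injective σ → (∀ j, x j ∈ 𝔓.comap (algebraMap A B) ↔ ∃ i, σ i = j) → GiraudNormalFormAt p (fun i => algebraMap A O (x (σ i)))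 (algebraMap A O a)) → LogChart.IsLogRegularLocal (kummerCone p j₀ (fun j => c₀ * Aexp j % p)) ((algebraMap B N).toMonoidHom.comp Φ) ∧ ∀ σN : O →+* N, σN.comp (algebraMap A O) = (algebraMap B N).comp (algebraMap A B) → divisorialMonoid (Ideal.span {σN (algebraMap A O (∏ j, x j))}) = IsUnit.submonoid N ⊔ MonoidHom.mrange ((algebraMap B N).toMonoidHom.comp Φ) := by
  intro A B O₀ O N _ _ _ _ _ _ _ _ _ _ _ _ _ _ _ p _ _ r x Aexp j₀ c₀ hc₀ a g u₁ hu₁ ha hprime hinj t ht hbir Φ hΦ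
    𝔮₀ _ _ hx₀ hli₀ 𝔓 _ _ _ hli hNF
  classical
  have hp : p.Prime := Fact.out
  set 𝔮 : Ideal A := 𝔓.comap (algebraMap A B) with h𝔮
  -- the local model `M = B ⊗_A O`
  let M := Localization (Algebra.algebraMapSubmonoid B 𝔮.primeCompl)
  letI : Algebra O M := localizationAlgebra 𝔮.primeCompl B
  haveI : IsScalarTower A O M := isScalarTower_localizationAlgebra 𝔮.primeCompl B
  have hinjM : Function.Injective (algebraMap O M) := injective_algebraMap_localModel 𝔮 hinj
  haveI : Algebra.IsIntegral O M := isIntegral_localModel (A := A) (B := B) 𝔮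
  haveI : IsDomain M := isDomain_localModel 𝔮 hinj
  haveI : IsIntegrallyClosed M := isIntegrallyClosed_localModel 𝔮 hinj
  haveI : CharP O p := charP_of_isLocalization_of_isDomain 𝔮.primeCompl
    (Ideal.primeCompl_le_nonZeroDivisors 𝔮) p
  haveI : CharP O₀ p := charP_of_isLocalization_of_isDomain 𝔮₀.primeCompl
    (Ideal.primeCompl_le_nonZeroDivisors 𝔮₀) p
  haveI := isDomain_of_isRegularLocalRing O
  haveI := isDomain_of_isRegularLocalRing O₀
  have hbirM := exists_mul_eq_aeval_of_isLocalization (O := O) (M := M) 𝔮 t hbir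
  have htM : algebraMap B M t ^ p = algebraMap O M (algebraMap A O a) := by
    rw [← map_pow, ht, ← IsScalarTower.algebraMap_apply, ← IsScalarTower.algebraMap_apply]
  -- the data at `O`
  set x' : Fin r → O := fun j => algebraMap A O (x j) with hx'def
  have hx'mem : ∀ j, x' j ∈ maximalIdeal O ↔ x j ∈ 𝔮 := fun j =>
    IsLocalization.AtPrime.to_map_mem_maximal_iff O 𝔮 (x j)
  have ha' : algebraMap A O a - algebraMap A O g ^ p =
      algebraMap A O u₁ ^ p * ∏ j, x' j ^ Aexp j := by
    simp only [hx'def, ← map_pow, ← map_prod, ← map_mul, ← map_sub, ha]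
  have hu₁' : IsUnit (algebraMap A O u₁) := hu₁.map _
  -- the chart through `M`
  set ψ : Multiplicative (kummerCone p j₀ (fun j => c₀ * Aexp j % p)) →* M :=
    (algebraMap B M).toMonoidHom.comp Φ with hψdef
  have hψ : ∀ v : kummerCone p j₀ (fun j => c₀ * Aexp j % p), ψ (Multiplicative.ofAdd v) ^ p =
      algebraMap O M (∏ j, x' j ^ (kummerExp p j₀ (fun j => c₀ * Aexp j % p) v j).toNat) := by
    intro v
    change (algebraMap B M (Φ (Multiplicative.ofAdd v))) ^ p = _
    rw [← map_pow, hΦ, ← IsScalarTower.algebraMap_apply, IsScalarTower.algebraMap_apply A O M]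
    simp only [hx'def, map_prod, map_pow]
  -- enumerate the coordinates through the point
  set J : Finset (Fin r) := Finset.univ.filter fun j => x j ∈ 𝔮 with hJdef
  obtain ⟨s, σ, hσinj, hσJ⟩ := exists_enum r J
  have hJσ : ∀ j, x j ∈ 𝔮 ↔ ∃ i, σ i = j := fun j => by rw [← hσJ j]; simp [hJdef]
  have hJσ' : ∀ j, x' j ∈ maximalIdeal O ↔ ∃ i, σ i = j := fun j => (hx'mem j).trans (hJσ j)
  have hσmem : ∀ i, x (σ i) ∈ 𝔮 := fun i => (hJσ _).mpr ⟨i, rfl⟩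
  have hσmem' : ∀ i, x' (σ i) ∈ maximalIdeal O := fun i => (hx'mem _).mpr (hσmem i)
  have hliσ := hli s σ hσinj hσmem
  have hxu : ∀ j, (∀ i, σ i ≠ j) → IsUnit (x' j) := fun j hj =>
    IsLocalRing.notMem_maximalIdeal.mp fun h => by
      obtain ⟨i, hi⟩ := (hJσ' j).mp h; exact hj i hi
  -- the product splits
  have hsplit : ∀ E : Fin r → ℕ, ∏ j, x' j ^ E j = (∏ j ∈ Jᶜ, x' j ^ E j) * ∏ i, x' (σ i) ^ E (σ i) := by
    intro E
    refine prod_eq_prod_compl_mul_prod_enum J σ hσinj (fun j => ?_) _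
    rw [← hJσ j]; simp [hJdef]
  have hcompl : ∀ j, j ∈ Jᶜ → IsUnit (x' j) := fun j hj => hxu j fun i hi => by
    have : σ i ∈ J := by rw [Finset.mem_filter]; exact ⟨Finset.mem_univ _, hσmem i⟩
    exact Finset.mem_compl.mp hj (hi ▸ this)
  -- the local model is local and the chart is log regular through `M`
  have key : IsLocalRing M ∧
      LogChart.IsLogRegularLocal (kummerCone p j₀ (fun j => c₀ * Aexp j % p)) ψ ∧
      divisorialMonoid (Ideal.span {algebraMap O M (∏ j, x' j)}) =
        IsUnit.submonoid M ⊔ MonoidHom.mrange ψ := by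
    by_cases hK1 : ∃ i, ¬ p ∣ Aexp (σ i)
    · -- some exponent prime to `p`: the toric model
      obtain ⟨i, hpA⟩ := hK1
      have hv : IsUnit (algebraMap A O u₁ ^ p * ∏ j ∈ Jᶜ, x' j ^ Aexp j) :=
        (hu₁'.pow _).mul (IsUnit.prod_iff.mpr fun j hj => (hcompl j hj).pow _)
      have ha'' : algebraMap A O a = algebraMap A O g ^ p +
          (algebraMap A O u₁ ^ p * ∏ j ∈ Jᶜ, x' j ^ Aexp j) * ∏ i, x' (σ i) ^ Aexp (σ i) := by
        rw [mul_assoc, ← hsplit, ← ha']; ring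
      have hnp := forall_pow_ne_of_kummerForm (K := FractionRing O) p hσmem' hliσ hv
        (fun i => Aexp (σ i)) hpA ha''
      haveI := isDomain_adjoinRoot_of_forall_pow_ne hp hnp
      exact isLogRegularLocal_of_kummerForm p x' Aexp j₀ c₀ hc₀
        (fun s σ hσ hmem => hli s σ hσ fun i => (hx'mem _).mp (hmem i))
        ⟨σ i, hσmem' i, hpA⟩ _ _ _ hu₁' ha' _ htM hinjM hbirM ψ hψ
    · -- all exponents divisible by `p`: the wound twist
      push Not at hK1
      have hA₀ : ¬ p ∣ Aexp j₀ := fun h => by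
        have h1 := Nat.mod_eq_zero_of_dvd (dvd_mul_of_dvd_right h c₀)
        rw [hc₀] at h1; exact one_ne_zero h1
      -- the Giraud form at the point is the wound one
      have hNFσ := hNF s σ hσinj hJσ
      set x₀ : Fin r → O₀ := fun j => algebraMap A O₀ (x j) with hx₀def
      have hx₀' : ∀ j, x₀ j ∈ maximalIdeal O₀ := fun j =>
        (IsLocalization.AtPrime.to_map_mem_maximal_iff O₀ 𝔮₀ (x j)).mpr (hx₀ j)
      have hu₁₀ : IsUnit (algebraMap A O₀ u₁ ^ p) := (hu₁.map _).pow _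
      have ha₀ : algebraMap A O₀ a = algebraMap A O₀ g ^ p + (hu₁₀.unit : O₀) * ∏ j, x₀ j ^ Aexp j := by
        rw [IsUnit.unit_spec]
        have : algebraMap A O₀ a - algebraMap A O₀ g ^ p = algebraMap A O₀ u₁ ^ p * ∏ j, x₀ j ^ Aexp j := by
          simp only [hx₀def, ← map_pow, ← map_prod, ← map_mul, ← map_sub, ha]
        rw [← this]; ring
      have hW : ∀ (i : Fin s) [(Ideal.span {x' (σ i)}).IsPrime],
          IsWoundTypeAt p (algebraMap O (Localization.AtPrime (Ideal.span {x' (σ i)})) (x' (σ i)))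
            (algebraMap O (Localization.AtPrime (Ideal.span {x' (σ i)})) (algebraMap A O a)) := by
        intro i _
        have hle₀ : Ideal.span {x (σ i)} ≤ 𝔮₀ := (Ideal.span_singleton_le_iff_mem _).mpr (hx₀ (σ i))
        have hle : Ideal.span {x (σ i)} ≤ 𝔮 := (Ideal.span_singleton_le_iff_mem _).mpr (hσmem i)
        haveI : (Ideal.span {x₀ (σ i)}).IsPrime := by
          have : Ideal.span {x₀ (σ i)} = (Ideal.span {x (σ i)}).map (algebraMap A O₀) := by
            rw [Ideal.map_span, Set.image_singleton]
          rw [this]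
          exact IsLocalization.isPrime_of_isPrime_disjoint 𝔮₀.primeCompl O₀ _ (hprime _)
            (Set.disjoint_left.mpr fun y hy hy' => hy (hle₀ hy'))
        have hw₀ := isWoundTypeAt_of_kummerForm p x₀ hx₀' hli₀ _ _ hu₁₀.unit Aexp ha₀ (σ i) j₀
          (hK1 i) hA₀ (Localization.AtPrime (Ideal.span {x₀ (σ i)}))
        exact isWoundTypeAt_of_atPrime_tower (A := A) 𝔮₀ 𝔮 hle₀ hle hw₀
      obtain ⟨g'', u'', B'', hu'', ha''⟩ :=
        woundForm_of_forall_isWoundTypeAt p (fun i => x' (σ i)) hσmem' hliσ _ hNFσ hW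
      have hxB : (∏ i, x' (σ i) ^ B'' i) ≠ 0 := Finset.prod_ne_zero_iff.mpr fun i _ =>
        pow_ne_zero _ fun h0 => RegularParameters.notMem_sq hliσ i (by
          rw [show algebraMap A O (x (σ i)) = 0 from h0]; exact Ideal.zero_mem _)
      haveI := isIntegrallyClosed_of_isRegularLocalRing O
      have hnp := forall_pow_ne_of_woundForm (K := FractionRing O) p hxB
        (forall_ne_pow_of_isWoundOrTransversalAt hu'') ha''
      haveI := isDomain_adjoinRoot_of_forall_pow_ne hp hnp
      obtain ⟨hreg, hlog, hdiv⟩ := isLogRegularLocal_kummerChart_of_dvd p x' Aexp j₀ c₀ hc₀ σ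
        hσinj hJσ' hliσ hK1 _ _ _ _ hu'' ha'' _ htM hinjM hbirM ψ hψ
      exact ⟨inferInstance, hlog, hdiv⟩
  obtain ⟨hloc, hlog, hdiv⟩ := key
  have hprod : algebraMap A O (∏ j, x j) = ∏ j, x' j := by simp only [hx'def, map_prod]
  rw [hprod]
  exact transfer_of_isLocalRing_localModel (A := A) 𝔓 hloc _ Φ _ hlog hdiv

/-! ## The orthant chart at every prime -/

/-- **The orthant chart is log regular at every prime, with divisorial stalk monoids** (centre
in wound/transversal form). See the module docstring. [cite: Kato1994, Def. (2.1) and Thm. 11.6] -/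
theorem localChart_pointwise_orthant : ∀ {A B O₀ O N : Type u} [CommRing A] [IsDomain A] [CommRing B] [IsDomain B] [IsIntegrallyClosed B] [CommRing O₀] [IsRegularLocalRing O₀] [CommRing O] [IsRegularLocalRing O] [CommRing N] [Algebra A B] [Algebra.IsIntegral A B] [Algebra A O₀] [Algebra A O] [Algebra B N] (p : ℕ) [Fact p.Prime] [CharP A p] {r : ℕ} (x : Fin r → A) (a g u : A) (Bexp : Fin r → ℕ), a = g ^ p + (∏ j, x j ^ Bexp j) ^ p * u → IsWoundOrTransversalAt p (fun j => algebraMap A O₀ (x j)) (algebraMap A O₀ u) → (∀ j, (Ideal.span {x j}).IsPrime) → Function.Injective (algebraMap A B) → ∀ (t : B), t ^ p = algebraMap A B a → (∀ z : B, ∃ d : A, d ≠ 0 ∧ ∃ q : Polynomial A, algebraMap A B d * z = Polynomial.aeval t q) → ∀ (Φ : Multiplicative (AddSubmonoid.nonneg (Fin r → ℤ)) →* B), (∀ v : AddSubmonoid.nonneg (Fin r → ℤ), Φ (Multiplicative.ofAdd v) = algebraMap A B (∏ j, x j ^ ((v : Fin r → ℤ) j).toNat)) → ∀ (𝔮₀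 : Ideal A) [𝔮₀.IsPrime] [IsLocalization.AtPrime O₀ 𝔮₀], (∀ j, x j ∈ 𝔮₀) → (∀ α : Fin r → O₀, ∑ i, α i * algebraMap A O₀ (x i) ∈ IsLocalRing.maximalIdeal O₀ ^ 2 → ∀ i, α i ∈ IsLocalRing.maximalIdeal O₀) → ∀ (𝔓 : Ideal B) [𝔓.IsPrime] [IsLocalization.AtPrime O (𝔓.comap (algebraMap A B))] [IsLocalization.AtPrime N 𝔓], (∀ (s : ℕ) (σ : Fin s → Fin r), Function.Injective σ → (∀ i, x (σ i) ∈ 𝔓.comap (algebraMap A B)) → ∀ α : Fin s → O, ∑ i, α i * algebraMap A O (x (σ i)) ∈ IsLocalRing.maximalIdeal O ^ 2 → ∀ i, α i ∈ IsLocalRing.maximalIdeal O) → (∀ (s : ℕ) (σ : Fin s → Fin r), Function.Injective σ → (∀ j, x j ∈ 𝔓.comap (algebraMap A B) ↔ ∃ i, σ i = j) → GiraudNormalFormAt p (fun i => algebraMap A O (x (σ i))) (algebraMap A O a)) → LogChart.IsLogRegularLocal (AddSubmonoid.nonneg (Fin r → ℤ)) ((algebraMap B N).toMonoidHom.comp Φ)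 ∧ ∀ σN : O →+* N, σN.comp (algebraMap A O) = (algebraMap B N).comp (algebraMap A B) → divisorialMonoid (Ideal.span {σN (algebraMap A O (∏ j, x j))}) = IsUnit.submonoid N ⊔ MonoidHom.mrange ((algebraMap B N).toMonoidHom.comp Φ) := by
  intro A B O₀ O N _ _ _ _ _ _ _ _ _ _ _ _ _ _ _ p _ _ r x a g u Bexp ha hwt hprime hinj t ht hbir Φ hΦ
    𝔮₀ _ _ hx₀ hli₀ 𝔓 _ _ _ hli hNF
  classical
  have hp : p.Prime := Fact.out
  set 𝔮 : Ideal A := 𝔓.comap (algebraMap A B) with h𝔮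
  -- the local model `M = B ⊗_A O`
  let M := Localization (Algebra.algebraMapSubmonoid B 𝔮.primeCompl)
  letI : Algebra O M := localizationAlgebra 𝔮.primeCompl B
  haveI : IsScalarTower A O M := isScalarTower_localizationAlgebra 𝔮.primeCompl B
  have hinjM : Function.Injective (algebraMap O M) := injective_algebraMap_localModel 𝔮 hinj
  haveI : Algebra.IsIntegral O M := isIntegral_localModel (A := A) (B := B) 𝔮
  haveI : IsDomain M := isDomain_localModel 𝔮 hinj
  haveI : IsIntegrallyClosed M := isIntegrallyClosed_localModel 𝔮 hinj
  haveI : CharP O p := charP_of_isLocalization_of_isDomain 𝔮.primeCompl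
    (Ideal.primeCompl_le_nonZeroDivisors 𝔮) p
  haveI : CharP O₀ p := charP_of_isLocalization_of_isDomain 𝔮₀.primeCompl
    (Ideal.primeCompl_le_nonZeroDivisors 𝔮₀) p
  haveI := isDomain_of_isRegularLocalRing O
  haveI := isDomain_of_isRegularLocalRing O₀
  have hbirM := exists_mul_eq_aeval_of_isLocalization (O := O) (M := M) 𝔮 t hbir
  have htM : algebraMap B M t ^ p = algebraMap O M (algebraMap A O a) := by
    rw [← map_pow, ht, ← IsScalarTower.algebraMap_apply, ← IsScalarTower.algebraMap_apply]
  -- the data at `O`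
  set x' : Fin r → O := fun j => algebraMap A O (x j) with hx'def
  have hx'mem : ∀ j, x' j ∈ maximalIdeal O ↔ x j ∈ 𝔮 := fun j =>
    IsLocalization.AtPrime.to_map_mem_maximal_iff O 𝔮 (x j)
  -- the chart through `M`
  set ψ : Multiplicative (AddSubmonoid.nonneg (Fin r → ℤ)) →* M :=
    (algebraMap B M).toMonoidHom.comp Φ with hψdef
  have hψ : ∀ v : AddSubmonoid.nonneg (Fin r → ℤ), ψ (Multiplicative.ofAdd v) =
      algebraMap O M (∏ j, x' j ^ ((v : Fin r → ℤ) j).toNat) := by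
    intro v
    change algebraMap B M (Φ (Multiplicative.ofAdd v)) = _
    rw [hΦ, ← IsScalarTower.algebraMap_apply, IsScalarTower.algebraMap_apply A O M]
    simp only [hx'def, map_prod, map_pow]
  -- enumerate the coordinates through the point
  set J : Finset (Fin r) := Finset.univ.filter fun j => x j ∈ 𝔮 with hJdef
  obtain ⟨s, σ, hσinj, hσJ⟩ := exists_enum r J
  have hJσ : ∀ j, x j ∈ 𝔮 ↔ ∃ i, σ i = j := fun j => by rw [← hσJ j]; simp [hJdef]
  have hJσ' : ∀ j, x' j ∈ maximalIdeal O ↔ ∃ i, σ i = j := fun j => (hx'mem j).trans (hJσ j)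
  have hσmem : ∀ i, x (σ i) ∈ 𝔮 := fun i => (hJσ _).mpr ⟨i, rfl⟩
  have hσmem' : ∀ i, x' (σ i) ∈ maximalIdeal O := fun i => (hx'mem _).mpr (hσmem i)
  have hliσ := hli s σ hσinj hσmem
  -- the types of the boundary components, read at the centre
  set x₀ : Fin r → O₀ := fun j => algebraMap A O₀ (x j) with hx₀def
  have hx₀' : ∀ j, x₀ j ∈ maximalIdeal O₀ := fun j =>
    (IsLocalization.AtPrime.to_map_mem_maximal_iff O₀ 𝔮₀ (x j)).mpr (hx₀ j)
  have ha₀ : algebraMap A O₀ a = algebraMap A O₀ g ^ p + (∏ j, x₀ j ^ Bexp j) ^ p * algebraMap A O₀ u := by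
    simp only [hx₀def, ← map_pow, ← map_prod, ← map_mul, ← map_add, ha]
  have hW : ∀ (i : Fin s) [(Ideal.span {x' (σ i)}).IsPrime],
      IsWoundTypeAt p (algebraMap O (Localization.AtPrime (Ideal.span {x' (σ i)})) (x' (σ i)))
        (algebraMap O (Localization.AtPrime (Ideal.span {x' (σ i)})) (algebraMap A O a)) := by
    intro i _
    have hle₀ : Ideal.span {x (σ i)} ≤ 𝔮₀ := (Ideal.span_singleton_le_iff_mem _).mpr (hx₀ (σ i))
    have hle : Ideal.span {x (σ i)} ≤ 𝔮 := (Ideal.span_singleton_le_iff_mem _).mpr (hσmem i)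
    haveI : (Ideal.span {x₀ (σ i)}).IsPrime := by
      have : Ideal.span {x₀ (σ i)} = (Ideal.span {x (σ i)}).map (algebraMap A O₀) := by
        rw [Ideal.map_span, Set.image_singleton]
      rw [this]
      exact IsLocalization.isPrime_of_isPrime_disjoint 𝔮₀.primeCompl O₀ _ (hprime _)
        (Set.disjoint_left.mpr fun y hy hy' => hy (hle₀ hy'))
    have hw₀ := isWoundTypeAt_of_woundForm p x₀ hx₀' hli₀ _ _ _ Bexp hwt ha₀ (σ i)
      (Localization.AtPrime (Ideal.span {x₀ (σ i)}))
    exact isWoundTypeAt_of_atPrime_tower (A := A) 𝔮₀ 𝔮 hle₀ hle hw₀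
  obtain ⟨g'', u'', B'', hu'', ha''⟩ :=
    woundForm_of_forall_isWoundTypeAt p (fun i => x' (σ i)) hσmem' hliσ _ (hNF s σ hσinj hJσ) hW
  have hxB : (∏ i, x' (σ i) ^ B'' i) ≠ 0 := Finset.prod_ne_zero_iff.mpr fun i _ =>
    pow_ne_zero _ fun h0 => RegularParameters.notMem_sq hliσ i (by
      rw [show algebraMap A O (x (σ i)) = 0 from h0]; exact Ideal.zero_mem _)
  haveI := isIntegrallyClosed_of_isRegularLocalRing O
  have hnp := forall_pow_ne_of_woundForm (K := FractionRing O) p hxB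
    (forall_ne_pow_of_isWoundOrTransversalAt hu'') ha''
  haveI := isDomain_adjoinRoot_of_forall_pow_ne hp hnp
  obtain ⟨hreg, hlog, hdiv⟩ := isLogRegularLocal_orthantChart p x' σ hσinj hJσ' hliσ _ _ _ _
    hu'' ha'' _ htM hinjM hbirM ψ hψ
  have hprod : algebraMap A O (∏ j, x j) = ∏ j, x' j := by simp only [hx'def, map_prod]
  rw [hprod]
  exact transfer_of_isLocalRing_localModel (A := A) 𝔓 inferInstance _ Φ _ hlog hdiv

end Summit.ResolutionOfSingularities.ResolutionOfSingularities.Theorems.PicoverLocalModel.LocalCharts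

end
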